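import Summits.QuantumFields.YangMills.Theorems.IsotropyFromPowerCountingTemperedCurvatureMomentsOfBddRenormalisation
import Literature.MathematicalPhysics.QuantumLattice.TorusWilsonMarkov

/-!
# Crux `TemperedCurvatureMoments` (T, stmt-QuantumFields-17721), line `Sketch` — stub C3 `stub_mesoOfShielded`

MESO(n) from CH_n: the assembly step of the Markov shielding.  Given (as hypotheses) the conditional
independence of separated cubes on Wilson's torus (C1) and the shielding inequality (C2, tower + generalised
Hölder), and the shielded moment bound CH_n (`hCH`), the true renormalised density
`c_kⁿ W_k(x) = ∫ ∏ᵢ c_k (F(τ_{xᵢ}Ũ) − m_k) dμ_k` at `s`-separated multi-sites of the inner half-box is bounded by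
`C' s^{-N}` eventually in `k`: with `ρ = s/8`, `R_k = ⌊ρ/a_k⌋ ≥ 1` and `2R_k + 2 ≤ L_k` eventually, the sites are
at torus sup-distance `≥ 4R_k ≥ 2R_k + 2` (a vector of `ℝ⁴` of norm `≥ s` has a coordinate `≥ s/2`), each factor
`φᵢ = c_k (F(τ_{xᵢ}Ũ) − m_k)` reads only the links of the unit cube at `xᵢ` (the plaquettes at the origin have
coordinates in `{0,1}`), so C1 + C2 give `|c_kⁿ W_k(x)| ≤ ∏ᵢ ‖E[φᵢ | extᵢ]‖_{Lⁿ} ≤ (C ρ^{-p})ⁿ ≤ Cⁿ 8^{Pn} s^{-Pn}`,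
`P = ⌈max p 0⌉`.

References: Glimm–Jaffe 1987 §19 (conditioning); Friedli–Velenik 2017 §6.3; Georgii 2011 Rem. 1.24.
-/

noncomputable section

-- tree-known workaround (cf. the imported support file)
attribute [-instance] SimplexCategory.instFintypeToTypeOrderHomFinHAddNatLenOfNat

namespace Summit.QuantumFields.YangMills.Theorems.TemperedCurvatureMoments.Sketch

open scoped BigOperators SchwartzMap ENNReal
open MeasureTheory Filter Topology ProbabilityTheory
open Literature.MathematicalPhysics.QuantumFieldTheory Literature.MathematicalPhysics.QuantumLattice
open Literature.MathematicalPhysics.AQFT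
open Literature.Probability.LatticeModels (box Site mem_box Torus.proj_apply)
open Summit.QuantumFields.YangMills.Theorems.OSLegsFromFemtoAndGap (torusMoment)
open Summit.QuantumFields.YangMills.Theorems.NPointIsotropy.Negative (E4)

variable {G : Type} [Group G] [TopologicalSpace G] [IsTopologicalGroup G] [CompactSpace G]
  [MeasurableSpace G] [BorelSpace G]

/-! ## Geometry: Euclidean separation ⇒ torus separation -/

/-- In `ℝ⁴`, if `‖a x − a y‖ ≥ s` (`a > 0`) then some coordinate has `|x ν − y ν| ≥ s / (2a)`
(`‖v‖ ≤ 2 maxᵥ |v ν|`). -/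
private theorem exists_coord_ge {a s : ℝ} (ha : 0 < a) {x y : Site 4}
    (h : s ≤ ‖a • siteToE x - a • siteToE y‖) :
    ∃ ν : Fin 4, s / (2 * a) ≤ |((x ν : ℝ) - y ν)| := by
  rcases le_or_gt s 0 with hs | hs
  · exact ⟨0, (div_nonpos_of_nonpos_of_nonneg hs (by positivity)).trans (abs_nonneg _)⟩
  by_contra hcon
  push Not at hcon
  have hlt : ‖a • siteToE x - a • siteToE y‖ ^ 2 < s ^ 2 := by
    rw [EuclideanSpace.real_norm_sq_eq]
    calc ∑ ν, ((a • siteToE x - a • siteToE y) ν) ^ 2 < ∑ _ν : Fin 4, (s / 2) ^ 2 := by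
          refine Finset.sum_lt_sum_of_nonempty Finset.univ_nonempty fun ν _ => ?_
          have hν : |(a • siteToE x - a • siteToE y) ν| < s / 2 := by
            simp only [PiLp.sub_apply, PiLp.smul_apply, siteToE_apply, smul_eq_mul, ← mul_sub, abs_mul,
              abs_of_pos ha]
            calc a * |((x ν : ℝ) - y ν)| < a * (s / (2 * a)) := mul_lt_mul_of_pos_left (hcon ν) ha
              _ = s / 2 := by field_simp
          have hs2 : |s / 2| = s / 2 := abs_of_pos (by positivity)
          exact sq_lt_sq.2 (by rwa [hs2])
      _ = s ^ 2 := by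
          rw [Finset.sum_const, Finset.card_univ, Fintype.card_fin]
          ring
  have hle : s ^ 2 ≤ ‖a • siteToE x - a • siteToE y‖ ^ 2 := pow_le_pow_left₀ hs.le h 2
  linarith

/-- Residues mod `2L+1`: if `2R+2 ≤ |d| ≤ L` then the residue of `d` is `≥ 2R+2`. -/
private theorem le_val_intCast {L R : ℕ} {d : ℤ} (hsep : (2 * R + 2 : ℤ) ≤ |d|) (hle : |d| ≤ L) :
    2 * R + 2 ≤ ((d : ZMod (2 * L + 1))).val := by
  rcases le_or_gt 0 d with hd | hd
  · rw [abs_of_nonneg hd] at hsep hle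
    lift d to ℕ using hd
    rw [Int.cast_natCast, ZMod.val_natCast_of_lt (by omega)]
    omega
  · rw [abs_of_neg hd] at hsep hle
    obtain ⟨e, he⟩ : ∃ e : ℕ, (e : ℤ) = -d := ⟨(-d).toNat, Int.toNat_of_nonneg (by omega)⟩
    obtain rfl : d = -(e : ℤ) := by omega
    have hne : ((e : ZMod (2 * L + 1))) ≠ 0 := by
      intro h0
      have h1 := congrArg ZMod.val h0
      rw [ZMod.val_natCast_of_lt (by omega), ZMod.val_zero] at h1
      omega
    rw [Int.cast_neg, Int.cast_natCast, ZMod.neg_val, if_neg hne, ZMod.val_natCast_of_lt (by omega)]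
    omega

/-- **Torus separation of separated sites of the inner half-box.**  If `x, y ∈ box 4 (L/2)` are at physical
distance `≥ s`, `4R ≤ s/(2a)` and `R ≥ 1`, then in some coordinate both residues `x ν − y ν`, `y ν − x ν`
mod `2L+1` are `≥ 2R+2`. -/
private theorem torus_separated {L R : ℕ} {a s : ℝ} (ha : 0 < a) (hR : (4 * R : ℝ) ≤ s / (2 * a))
    (hR1 : 1 ≤ R) {x y : Site 4} (hx : x ∈ box 4 (L / 2)) (hy : y ∈ box 4 (L / 2))
    (h : s ≤ ‖a • siteToE x - a • siteToE y‖) :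
    ∃ ν : Fin 4, 2 * R + 2 ≤ (((x ν : ℤ) : ZMod (2 * L + 1)) - ((y ν : ℤ) : ZMod (2 * L + 1))).val ∧
      2 * R + 2 ≤ (((y ν : ℤ) : ZMod (2 * L + 1)) - ((x ν : ℤ) : ZMod (2 * L + 1))).val := by
  obtain ⟨ν, hν⟩ := exists_coord_ge ha h
  have h4 : ((4 * R : ℕ) : ℝ) ≤ ((|x ν - y ν| : ℤ) : ℝ) := by push_cast; exact hR.trans hν
  have h4' : ((4 * R : ℕ) : ℤ) ≤ |x ν - y ν| := by exact_mod_cast h4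
  have h1 : (2 * R + 2 : ℤ) ≤ |x ν - y ν| := by push_cast at h4'; omega
  have hL2 : 2 * ((L / 2 : ℕ) : ℤ) ≤ (L : ℤ) := by exact_mod_cast Nat.mul_div_le L 2
  have hxν := (mem_box.1 hx) ν
  have hyν := (mem_box.1 hy) ν
  have h2 : |x ν - y ν| ≤ (L : ℤ) := by
    rw [abs_le]
    constructor <;> omega
  refine ⟨ν, ?_, ?_⟩
  · rw [← Int.cast_sub]
    exact le_val_intCast h1 h2
  · rw [← Int.cast_sub]
    exact le_val_intCast (by rwa [abs_sub_comm]) (by rwa [abs_sub_comm])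

/-! ## The shielded observables `φᵢ = c (F(τ_{y}Ũ) − m)` -/

-- adapted from `fst_mem_Icc_of_mem_curvature_supp` (Literature/…/LatticeGaugeDLRCovarianceSplit.lean)
/-- Edges in the support of the curvature species have all coordinates in `{0, 1}`. -/
private theorem fst_mem_Icc_of_mem_supp (r : LatticeRep G) {e : Site 4 × Fin 4}
    (he : e ∈ r.curvature.supp) (l : Fin 4) : 0 ≤ e.1 l ∧ e.1 l ≤ 1 := by
  have hsupp : r.curvature.supp =
      Finset.univ.biUnion fun p : Fin 4 × Fin 4 => originPlaquetteSupport p.1 p.2 := rfl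
  rw [hsupp, Finset.mem_biUnion] at he
  obtain ⟨p, -, hp⟩ := he
  simp only [originPlaquetteSupport, Finset.mem_insert, Finset.mem_singleton] at hp
  rcases hp with rfl | rfl | rfl | rfl
  · simp
  · simp only [Pi.single_apply]
    split_ifs <;> simp
  · simp only [Pi.single_apply]
    split_ifs <;> simp
  · simp

/-- **Dependence.** `φ = c (F(τ_y Ũ) − m)` reads only the torus links `ℓ` with
`(ℓ ν − y ν + R) mod (2L+1) ≤ 2R` for all `ν` (the unit cube at `y` sits in the cube of radius `R ≥ 1`). -/
private theorem dependsOn_phi (r : LatticeRep G) {L R : ℕ} (hR1 : 1 ≤ R) (hRL : R + 1 < 2 * L + 1)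
    (c m : ℝ) (y : Site 4) :
    DependsOn (fun U : GaugeConfig 4 (2 * L + 1) G =>
        c * (r.curvature.F (configShift (-y) (torusLift (2 * L + 1) U)) - m))
      {ℓ : Edge 4 (2 * L + 1) | ∀ ν : Fin 4,
        (ℓ.1 ν - ((y ν : ℤ) : ZMod (2 * L + 1)) + (R : ZMod (2 * L + 1))).val ≤ 2 * R} := by
  intro U V hUV
  refine congrArg (fun z : ℝ => c * (z - m)) ?_
  refine r.curvature.isCylinder fun e he => ?_
  simp only [configShift_apply, torusLift, Function.comp_apply]
  refine hUV _ fun ν => ?_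
  have hc := fst_mem_Icc_of_mem_supp r he ν
  obtain ⟨e', he'⟩ : ∃ e' : ℕ, (e' : ℤ) = e.1 ν := ⟨(e.1 ν).toNat, Int.toNat_of_nonneg hc.1⟩
  have he1 : e' ≤ 1 := by omega
  simp only [torusEdge, Torus.proj_apply, sub_neg_eq_add, Pi.add_apply, Int.cast_add,
    add_sub_cancel_right, ← he', Int.cast_natCast]
  rw [← Nat.cast_add, ZMod.val_natCast_of_lt (by omega)]
  omega

/-- **Measurability** of `φ`. -/
private theorem measurable_phi (r : LatticeRep G) (L : ℕ) (c m : ℝ) (y : Site 4) :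
    Measurable fun U : GaugeConfig 4 (2 * L + 1) G =>
      c * (r.curvature.F (configShift (-y) (torusLift (2 * L + 1) U)) - m) :=
  ((r.curvature.measurable.comp ((configShift _).measurable.comp (measurable_torusLift _))).sub_const
    _).const_mul _

/-- **Boundedness** of `φ`. -/
private theorem abs_phi_le (r : LatticeRep G) {M : ℝ} (hM : ∀ V, |r.curvature.F V| ≤ M) (L : ℕ)
    (c m : ℝ) (y : Site 4) (U : GaugeConfig 4 (2 * L + 1) G) :
    |c * (r.curvature.F (configShift (-y) (torusLift (2 * L + 1) U)) - m)| ≤ |c| * (M + |m|) := by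
  rw [abs_mul]
  exact mul_le_mul_of_nonneg_left ((abs_sub _ _).trans (add_le_add (hM _) le_rfl)) (abs_nonneg _)

/-- `cⁿ W(x) = ∫ ∏ᵢ φᵢ`. -/
private theorem pow_mul_torusMoment (r : LatticeRep G) (β : ℝ) (L : ℕ) (c m : ℝ) {n : ℕ}
    (x : Fin n → Site 4) :
    c ^ n * torusMoment r.ρ β L r.curvature.F m x =
      ∫ U, ∏ i, c * (r.curvature.F (configShift (-(x i)) (torusLift (2 * L + 1) U)) - m)
        ∂(wilsonMeasure (d := 4) (L := 2 * L + 1) r.ρ β) := by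
  rw [torusMoment, ← integral_const_mul]
  refine integral_congr_ae (ae_of_all _ fun U => ?_)
  simp only
  rw [Finset.prod_mul_distrib, Finset.prod_const, Finset.card_univ, Fintype.card_fin]

/-! ## Analysis: a.e.-equal versions, the final power count, the eventual regime -/

/-- Replace a conditional expectation by an a.e.-equal one inside the `Lⁿ` bound. -/
private theorem rpow_integral_le_of_ae_eq {Ω : Type*} {m m' m0 : MeasurableSpace Ω} {μ : Measure Ω}
    {f : Ω → ℝ} {n : ℕ} {B : ℝ} (h : μ[f|m] =ᵐ[μ] μ[f|m'])
    (hB : (∫ ω, |(μ[f|m']) ω| ^ n ∂μ) ^ ((n : ℝ)⁻¹) ≤ B) :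
    (∫ ω, |(μ[f|m]) ω| ^ n ∂μ) ^ ((n : ℝ)⁻¹) ≤ B := by
  have h' : (fun ω => |(μ[f|m]) ω| ^ n) =ᵐ[μ] fun ω => |(μ[f|m']) ω| ^ n :=
    h.mono fun ω hω => by simp only [hω]
  rwa [integral_congr_ae h']

/-- `(C (s/8)^{-p})ⁿ ≤ Cⁿ 8^{Pn} s^{-Pn}` for `0 < s ≤ 1`, `P = ⌈max p 0⌉₊`. -/
private theorem pow_bound {C p s : ℝ} (hC : 0 < C) (hs : 0 < s) (hs1 : s ≤ 1) (n : ℕ) :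
    (C * (s / 8) ^ (-p)) ^ n ≤ C ^ n * 8 ^ (⌈max p 0⌉₊ * n) * s⁻¹ ^ (⌈max p 0⌉₊ * n) := by
  have hρ : 0 < s / 8 := by positivity
  have hρ1 : s / 8 ≤ 1 := by linarith
  have h1 : (s / 8) ^ (-p) ≤ (s / 8) ^ (-(⌈max p 0⌉₊ : ℝ)) := by
    refine Real.rpow_le_rpow_of_exponent_ge hρ hρ1 ?_
    have : p ≤ ⌈max p 0⌉₊ := (le_max_left p 0).trans (Nat.le_ceil _)
    linarith
  have h2 : (s / 8) ^ (-(⌈max p 0⌉₊ : ℝ)) = 8 ^ ⌈max p 0⌉₊ * s⁻¹ ^ ⌈max p 0⌉₊ := by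
    rw [Real.rpow_neg hρ.le, Real.rpow_natCast, ← inv_pow, inv_div, div_eq_mul_inv, mul_pow]
  calc (C * (s / 8) ^ (-p)) ^ n ≤ (C * (8 ^ ⌈max p 0⌉₊ * s⁻¹ ^ ⌈max p 0⌉₊)) ^ n :=
        pow_le_pow_left₀ (by positivity) (mul_le_mul_of_nonneg_left (h1.trans_eq h2) hC.le) n
    _ = C ^ n * 8 ^ (⌈max p 0⌉₊ * n) * s⁻¹ ^ (⌈max p 0⌉₊ * n) := by
        rw [mul_pow, mul_pow, pow_mul, pow_mul]
        ring

/-- Eventually `a_k ≤ ρ` and `a_k L_k ≥ 4`. -/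
private theorem eventually_small_and_large {ι : Type} (sch : SpeciesScheme ι) {ρ : ℝ} (hρ : 0 < ρ) :
    ∀ᶠ k in atTop, sch.a k ≤ ρ ∧ 4 ≤ sch.a k * sch.L k :=
  (sch.tendsto_a.eventually (eventually_le_nhds hρ)).and (sch.tendsto_L.eventually_ge_atTop 4)

/-- The radius `R = ⌊ρ/a⌋₊` in the eventual regime: `1 ≤ R`, `2R+2 ≤ L`, `4R ≤ (8ρ)/(2a)`. -/
private theorem radius_bounds {a ρ : ℝ} {L : ℕ} (ha : 0 < a) (hρ1 : ρ ≤ 1) (haρ : a ≤ ρ)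
    (haL : 4 ≤ a * L) :
    1 ≤ ⌊ρ / a⌋₊ ∧ 2 * ⌊ρ / a⌋₊ + 2 ≤ L ∧ (4 * ⌊ρ / a⌋₊ : ℝ) ≤ 8 * ρ / (2 * a) := by
  have hR1 : 1 ≤ ⌊ρ / a⌋₊ := Nat.floor_pos.2 ((one_le_div ha).2 haρ)
  have hRle : (⌊ρ / a⌋₊ : ℝ) ≤ ρ / a := Nat.floor_le (div_nonneg (ha.le.trans haρ) ha.le)
  refine ⟨hR1, ?_, ?_⟩
  · have h : (2 * ⌊ρ / a⌋₊ + 2 : ℝ) ≤ L := by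
      refine le_of_mul_le_mul_left ?_ ha
      calc a * (2 * ⌊ρ / a⌋₊ + 2) ≤ a * (2 * (ρ / a) + 2) := by gcongr
        _ = 2 * ρ + 2 * a := by field_simp
        _ ≤ 4 := by linarith
        _ ≤ a * L := haL
    exact_mod_cast h
  · calc (4 * ⌊ρ / a⌋₊ : ℝ) ≤ 4 * (ρ / a) := by gcongr
      _ = 8 * ρ / (2 * a) := by field_simp; ring

/-! ## The assembly -/

/-- **Stub C3 — MESO from CH (assembly of the Markov shielding).**  Given C1 and C2 (as hypotheses), for a
scheme `sch`, representation `r` and degree `n > 0`: if CH_n holds — `∃ C p, ∀ ρ ∈ (0,1], ∃ k₀, ∀ k ≥ k₀`, at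
every site `y` of the inner half-box the `Lⁿ(μ_k)` norm of the shielded renormalised curvature
`E_k[c_k(F(τ_yŨ) − m_k) | links based outside the sup-cube of radius ⌊ρ/a_k⌋ around y]` is `≤ C ρ^{-p}` —
then MESO(n) holds: with `ρ = s/8`, `R_k = ⌊ρ/a_k⌋ ≥ 1`, `s`-separated sites of the inner half-box have
cubes at torus sup-distance `≥ 4R_k ≥ 2R_k+2`, so `c_kⁿ W_k(x) = E_k ∏ᵢ φᵢ` with `φᵢ = c_k(F(τ_{xᵢ}Ũ) − m_k)`
reading the radius-`1` cube, C1 + C2 give `|c_kⁿ W_k(x)| ≤ (C ρ^{-p})ⁿ ≤ Cⁿ 8^{⌈p⌉n} s^{-⌈p⌉n}`. [folklore] -/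
theorem stub_mesoOfShielded
    (hC1 : ∀ (G : Type) [Group G] [TopologicalSpace G] [IsTopologicalGroup G] [CompactSpace G]
      [MeasurableSpace G] [BorelSpace G] (r : LatticeRep G) (β : ℝ) (S R : ℕ), 2 * R + 2 ≤ S →
      ∀ {n : ℕ} (y : Fin n → Site 4),
      (∀ i j, i ≠ j → ∃ ν : Fin 4,
        2 * R + 2 ≤ ((((y i ν : ℤ) : ZMod (2 * S + 1)) - ((y j ν : ℤ) : ZMod (2 * S + 1))).val) ∧
        2 * R + 2 ≤ ((((y j ν : ℤ) : ZMod (2 * S + 1)) - ((y i ν : ℤ) : ZMod (2 * S + 1))).val)) →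
      ∀ (φ : Fin n → GaugeConfig 4 (2 * S + 1) G → ℝ), (∀ i, Measurable (φ i)) →
      (∀ i, ∃ M : ℝ, ∀ U, |φ i U| ≤ M) →
      (∀ i, DependsOn (φ i) {ℓ : Edge 4 (2 * S + 1) |
        ∀ ν : Fin 4, (ℓ.1 ν - ((y i ν : ℤ) : ZMod (2 * S + 1)) + (R : ZMod (2 * S + 1))).val ≤ 2 * R}) →
      (wilsonMeasure r.ρ β : Measure (GaugeConfig 4 (2 * S + 1) G))[(fun U => ∏ i, φ i U) |
          cylinderEvents {ℓ : Edge 4 (2 * S + 1) | ∀ i : Fin n,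
            ¬ ∀ ν : Fin 4, (ℓ.1 ν - ((y i ν : ℤ) : ZMod (2 * S + 1)) + (R : ZMod (2 * S + 1))).val ≤ 2 * R}]
        =ᵐ[(wilsonMeasure r.ρ β : Measure (GaugeConfig 4 (2 * S + 1) G))]
        (fun U => ∏ i, ((wilsonMeasure r.ρ β : Measure (GaugeConfig 4 (2 * S + 1) G))[φ i |
          cylinderEvents {ℓ : Edge 4 (2 * S + 1) | ∀ i : Fin n,
            ¬ ∀ ν : Fin 4, (ℓ.1 ν - ((y i ν : ℤ) : ZMod (2 * S + 1)) + (R : ZMod (2 * S + 1))).val ≤ 2 * R}])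
              U) ∧
      ∀ i : Fin n,
        (wilsonMeasure r.ρ β : Measure (GaugeConfig 4 (2 * S + 1) G))[φ i |
          cylinderEvents {ℓ : Edge 4 (2 * S + 1) | ∀ i : Fin n,
            ¬ ∀ ν : Fin 4, (ℓ.1 ν - ((y i ν : ℤ) : ZMod (2 * S + 1)) + (R : ZMod (2 * S + 1))).val ≤ 2 * R}]
        =ᵐ[(wilsonMeasure r.ρ β : Measure (GaugeConfig 4 (2 * S + 1) G))]
        (wilsonMeasure r.ρ β : Measure (GaugeConfig 4 (2 * S + 1) G))[φ i |
          cylinderEvents {ℓ : Edge 4 (2 * S + 1) |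
            ¬ ∀ ν : Fin 4, (ℓ.1 ν - ((y i ν : ℤ) : ZMod (2 * S + 1)) + (R : ZMod (2 * S + 1))).val ≤ 2 * R}])
    (hC2 : ∀ {Ω : Type} {m m0 : MeasurableSpace Ω}, m ≤ m0 → ∀ (μ : Measure Ω) [IsProbabilityMeasure μ]
      {n : ℕ}, 0 < n → ∀ (φ : Fin n → Ω → ℝ), (∀ i, AEStronglyMeasurable (φ i) μ) →
      (∀ i, ∃ M : ℝ, ∀ ω, |φ i ω| ≤ M) →
      μ[(fun ω => ∏ i, φ i ω) | m] =ᵐ[μ] (fun ω => ∏ i, (μ[φ i | m]) ω) →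
      |∫ ω, ∏ i, φ i ω ∂μ| ≤ ∏ i, (∫ ω, |(μ[φ i | m]) ω| ^ n ∂μ) ^ ((n : ℝ)⁻¹))
    (r : LatticeRep G) (sch : SpeciesScheme (YMSpecies G)) {n : ℕ} (hn : 0 < n)
    (hCH : ∃ (C p : ℝ), 0 < C ∧ ∀ ρ : ℝ, 0 < ρ → ρ ≤ 1 → ∃ k₀ : ℕ, ∀ k : ℕ, k₀ ≤ k →
      ∀ y : Site 4, y ∈ box 4 (sch.L k / 2) →
        (∫ U, |((wilsonMeasure r.ρ (sch.β k) : Measure (GaugeConfig 4 (2 * sch.L k + 1) G))[(fun U =>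
            sch.c r.curvature k *
              (r.curvature.F (configShift (-y) (torusLift (2 * sch.L k + 1) U)) - sch.m r.curvature k)) |
            cylinderEvents {ℓ : Edge 4 (2 * sch.L k + 1) | ¬ ∀ ν : Fin 4,
              (ℓ.1 ν - ((y ν : ℤ) : ZMod (2 * sch.L k + 1)) +
                ((⌊ρ / sch.a k⌋₊ : ℕ) : ZMod (2 * sch.L k + 1))).val ≤ 2 * ⌊ρ / sch.a k⌋₊}]) U| ^ n
          ∂(wilsonMeasure r.ρ (sch.β k) : Measure (GaugeConfig 4 (2 * sch.L k + 1) G))) ^ ((n : ℝ)⁻¹) ≤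
          C * ρ ^ (-p)) :
    ∃ (C : ℝ) (N : ℕ), 0 < C ∧ ∀ s : ℝ, 0 < s → s ≤ 1 → ∃ k₀ : ℕ, ∀ k : ℕ, k₀ ≤ k →
      ∀ x : Fin n → Site 4, (∀ i, x i ∈ box 4 (sch.L k / 2)) →
        (∀ i j, i ≠ j → s ≤ ‖sch.a k • siteToE (x i) - sch.a k • siteToE (x j)‖) →
        |(sch.c r.curvature k) ^ n *
            torusMoment r.ρ (sch.β k) (sch.L k) r.curvature.F (sch.m r.curvature k) x| ≤ C * s⁻¹ ^ N := by
  obtain ⟨C, p, hC, hCH⟩ := hCH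
  obtain ⟨M, hM⟩ := r.curvature.bounded
  refine ⟨C ^ n * 8 ^ (⌈max p 0⌉₊ * n), ⌈max p 0⌉₊ * n, by positivity, ?_⟩
  intro s hs hs1
  have hρ : 0 < s / 8 := by positivity
  have hρ1 : s / 8 ≤ 1 := by linarith
  obtain ⟨k₁, hk₁⟩ := hCH (s / 8) hρ hρ1
  obtain ⟨k₀, hk₀⟩ := Filter.eventually_atTop.1
    ((eventually_ge_atTop k₁).and (eventually_small_and_large sch hρ))
  refine ⟨k₀, fun k hk x hx hxs => ?_⟩
  obtain ⟨hk1, hak, haL⟩ := hk₀ k hk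
  have ha0 : 0 < sch.a k := sch.a_pos k
  obtain ⟨hR1, hRL, hR4⟩ := radius_bounds (L := sch.L k) ha0 hρ1 hak haL
  have hR4' : (4 * ⌊s / 8 / sch.a k⌋₊ : ℝ) ≤ s / (2 * sch.a k) := by
    have h8 : 8 * (s / 8) = s := by ring
    rwa [h8] at hR4
  -- the shielded observables
  obtain ⟨φ, hφ⟩ : ∃ φ : Fin n → GaugeConfig 4 (2 * sch.L k + 1) G → ℝ, φ = fun i U =>
      sch.c r.curvature k *
        (r.curvature.F (configShift (-(x i)) (torusLift (2 * sch.L k + 1) U)) - sch.m r.curvature k) :=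
    ⟨_, rfl⟩
  have hφm : ∀ i, Measurable (φ i) := fun i => by
    rw [hφ]
    exact measurable_phi r (sch.L k) _ _ (x i)
  have hφb : ∀ i, ∃ M' : ℝ, ∀ U, |φ i U| ≤ M' := fun i =>
    ⟨|sch.c r.curvature k| * (M + |sch.m r.curvature k|), fun U => by
      rw [hφ]
      exact abs_phi_le r hM (sch.L k) _ _ (x i) U⟩
  have hφd : ∀ i, DependsOn (φ i) {ℓ : Edge 4 (2 * sch.L k + 1) | ∀ ν : Fin 4,
      (ℓ.1 ν - ((x i ν : ℤ) : ZMod (2 * sch.L k + 1)) +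
        ((⌊s / 8 / sch.a k⌋₊ : ℕ) : ZMod (2 * sch.L k + 1))).val ≤ 2 * ⌊s / 8 / sch.a k⌋₊} := fun i => by
    rw [hφ]
    exact dependsOn_phi r hR1 (by omega) _ _ (x i)
  have hsep : ∀ i j, i ≠ j → ∃ ν : Fin 4,
      2 * ⌊s / 8 / sch.a k⌋₊ + 2 ≤ ((((x i ν : ℤ) : ZMod (2 * sch.L k + 1)) -
        ((x j ν : ℤ) : ZMod (2 * sch.L k + 1))).val) ∧
      2 * ⌊s / 8 / sch.a k⌋₊ + 2 ≤ ((((x j ν : ℤ) : ZMod (2 * sch.L k + 1)) -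
        ((x i ν : ℤ) : ZMod (2 * sch.L k + 1))).val) := fun i j hij =>
    torus_separated ha0 hR4' hR1 (hx i) (hx j) (hxs i j hij)
  -- (C1): conditional independence and locality of the shielded means
  obtain ⟨hci, hcii⟩ := hC1 G r (sch.β k) (sch.L k) ⌊s / 8 / sch.a k⌋₊ hRL x hsep φ hφm hφb hφd
  -- (C2): the shielding inequality
  haveI := isProbabilityMeasure_wilsonMeasure (d := 4) (L := 2 * sch.L k + 1) r.ρ r.continuous (sch.β k)
  have hH := hC2 cylinderEvents_le_pi (wilsonMeasure (d := 4) (L := 2 * sch.L k + 1) r.ρ (sch.β k)) hn φ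
    (fun i => (hφm i).aestronglyMeasurable) hφb hci
  have hW : sch.c r.curvature k ^ n *
      torusMoment r.ρ (sch.β k) (sch.L k) r.curvature.F (sch.m r.curvature k) x =
      ∫ U, ∏ i, φ i U ∂(wilsonMeasure (d := 4) (L := 2 * sch.L k + 1) r.ρ (sch.β k)) := by
    rw [hφ]
    exact pow_mul_torusMoment r (sch.β k) (sch.L k) _ _ x
  rw [hW]
  refine hH.trans ?_
  calc ∏ i, (∫ U, |((wilsonMeasure (d := 4) (L := 2 * sch.L k + 1) r.ρ (sch.β k))[φ i |
          cylinderEvents {ℓ : Edge 4 (2 * sch.L k + 1) | ∀ i : Fin n, ¬ ∀ ν : Fin 4,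
            (ℓ.1 ν - ((x i ν : ℤ) : ZMod (2 * sch.L k + 1)) +
              ((⌊s / 8 / sch.a k⌋₊ : ℕ) : ZMod (2 * sch.L k + 1))).val ≤ 2 * ⌊s / 8 / sch.a k⌋₊}]) U| ^ n
          ∂(wilsonMeasure (d := 4) (L := 2 * sch.L k + 1) r.ρ (sch.β k))) ^ ((n : ℝ)⁻¹)
      ≤ ∏ _i : Fin n, C * (s / 8) ^ (-p) := by
        refine Finset.prod_le_prod (fun i _ => by positivity) fun i _ => ?_
        refine rpow_integral_le_of_ae_eq (hcii i) ?_
        have h := hk₁ k hk1 (x i) (hx i)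
        rw [hφ]
        exact h
    _ = (C * (s / 8) ^ (-p)) ^ n := by rw [Finset.prod_const, Finset.card_univ, Fintype.card_fin]
    _ ≤ C ^ n * 8 ^ (⌈max p 0⌉₊ * n) * s⁻¹ ^ (⌈max p 0⌉₊ * n) := pow_bound hC hs hs1 n

end Summit.QuantumFields.YangMills.Theorems.TemperedCurvatureMoments.Sketch

end
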